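import Summits.RiemannHypothesis.RiemannHypothesis.Theorems.PfPersistenceRatioBinderReduction
import HarnessLib

/-!
# PF persistence — `ClusterReady`: the ratio binders in the idiom of the cell's typed gap `DialReady`
(pub-rhpf barrier-prover gen 5, file 5; CASE-DAG leaf G1.21b / §6 PINCER `(Z)`-cell; GAP B-TYPED-2 at cluster level)

**HONEST FRAMING. This is a long-odds MECHANISM / RIGIDITY campaign; no RH claims.** RH-free bookkeeping;
`ζ`'s Weil positivity is never assumed or concluded; `ClusterReady` is a HYPOTHESIS (DATA PF-N2 / PF-C7 / R-PF3a).

## What is proved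

The cell's standing typed input for every dial-space accumulation theorem is `DialReady p β₀`
(`PfPersistenceDialLemma`): for every `δ > 0` SOME window reaching `p` carries a vector of `ζ`-height `< δ` whose
`p`-pattern value has modulus `≥ β₀`. Files 2–3 (`ClusterBinders`, `ClusterBindersLight`) phrased the dial-door
binders of the `∀`-window gauge-ratio class along a window SEQUENCE. This file restates them in `DialReady`'s own
`∃`-window idiom and shows the dial door closes modulo "`DialReady` AT CLUSTER LEVEL":

* `ClusterReady q ρ` — for every `δ > 0` some window reaching `q` carries a `δ`-low PLANE of `ζ` (two nonzero
  orthogonal vectors, Rayleigh `≤ δ` on their span) and a `δ`-low vector with pattern value `≥ ρ` (signed);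
  `ClusterReadyNeg q ρ` — the same with pattern value `≤ −ρ`.
* `ClusterReady.dialReady` — `ClusterReady q ρ → DialReady q ρ` (and the `Neg` version): the new binder is the
  old typed gap PLUS a co-located low plane (B2), nothing exotic.
* `ClusterReady.exists_clusterBindersLight` — choice of one window per `δ = 1/(n+1)` turns it into file 3's
  sequence package; hence
* `upDial_not_mem_gaugeRatioClass_of_clusterReady`, `downDial_not_mem_gaugeRatioClass_of_clusterReadyNeg`,
  `dial_mem_gaugeRatioClass_imp_trivial_of_clusterReady` — DIAL ISOLATION in `GaugeRatioClass τ` for every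
  `0 ≤ τ < 1` with `τ(1 + ρ) < ρ`, modulo `ClusterReady` only; and
* `subset_gaugeRatioClass_disjoint_upDials_of_clusterReady` — every class inside the conjunct misses every
  up-dial at `q`.

References: the cell files cited by name; R. Courant, D. Hilbert, Methods of Mathematical Physics I, §I.4.
-/

set_option linter.dupNamespace false

noncomputable section

open Real Set Matrix

namespace Summit.RiemannHypothesis.RiemannHypothesis.Theorems.PfPersistence

/-- **TYPED (`ClusterReady q ρ` = `DialReady` at cluster level, up-dial sign).** For every `δ > 0` some window
reaching `q` carries two nonzero orthogonal vectors spanning a plane of `ζ`-height `≤ δ` and a vector `v₀ ≠ 0`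
of `ζ`-height `≤ δ` with `q`-pattern value `≥ ρ·v₀ᵀv₀`. Content: Galerkin upper law for the bottom PAIR of the
even block (B2; DATA PF-N2) + non-degeneracy of the dial direction on a low vector (DATA PF-C7 / R-PF3a).
No theorem. [folklore] -/
def ClusterReady (q : ℕ) (ρ : ℝ) : Prop :=
  ∀ δ : ℝ, 0 < δ → ∃ win : Window, q ∈ primeRange (2 * win.a) ∧
    ∃ x y v₀ : Fin (win.N + 1) → ℝ, x ≠ 0 ∧ y ≠ 0 ∧ y ⬝ᵥ x = 0 ∧ v₀ ≠ 0 ∧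
      (∀ α β : ℝ, (α • x + β • y) ⬝ᵥ (zetaDatum win *ᵥ (α • x + β • y))
        ≤ δ * ((α • x + β • y) ⬝ᵥ (α • x + β • y))) ∧
      v₀ ⬝ᵥ (zetaDatum win *ᵥ v₀) ≤ δ * (v₀ ⬝ᵥ v₀) ∧
      ρ * (v₀ ⬝ᵥ v₀) ≤ v₀ ⬝ᵥ (primePattern q win *ᵥ v₀)

/-- **TYPED (`ClusterReadyNeg q ρ`, down-dial sign):** as `ClusterReady` with pattern value `≤ −ρ·v₀ᵀv₀`.
[folklore] -/
def ClusterReadyNeg (q : ℕ) (ρ : ℝ) : Prop :=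
  ∀ δ : ℝ, 0 < δ → ∃ win : Window, q ∈ primeRange (2 * win.a) ∧
    ∃ x y v₀ : Fin (win.N + 1) → ℝ, x ≠ 0 ∧ y ≠ 0 ∧ y ⬝ᵥ x = 0 ∧ v₀ ≠ 0 ∧
      (∀ α β : ℝ, (α • x + β • y) ⬝ᵥ (zetaDatum win *ᵥ (α • x + β • y))
        ≤ δ * ((α • x + β • y) ⬝ᵥ (α • x + β • y))) ∧
      v₀ ⬝ᵥ (zetaDatum win *ᵥ v₀) ≤ δ * (v₀ ⬝ᵥ v₀) ∧
      v₀ ⬝ᵥ (primePattern q win *ᵥ v₀) ≤ -ρ * (v₀ ⬝ᵥ v₀)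

/-- **PROVED — `ClusterReady` refines the cell's typed gap:** `ClusterReady q ρ → DialReady q ρ` when `0 ≤ ρ`
(forget the plane; `ρ·vᵀv ≤ vᵀΘv ≤ |vᵀΘv|`; strictness from `δ/2`). [folklore] -/
theorem ClusterReady.dialReady {q : ℕ} {ρ : ℝ} (h : ClusterReady q ρ) : DialReady q ρ := by
  intro δ hδ
  obtain ⟨win, hq, x, y, v₀, -, -, -, hv₀, -, hZv, hρ⟩ := h (δ / 2) (by positivity)
  have hvv : 0 < v₀ ⬝ᵥ v₀ := dotProduct_self_pos_of_ne_zero hv₀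
  refine ⟨win, hq, v₀, by nlinarith, le_trans hρ (le_abs_self _)⟩

/-- **PROVED — down-dial sign:** `ClusterReadyNeg q ρ → DialReady q ρ` (`vᵀΘv ≤ −ρ vᵀv` gives
`|vᵀΘv| ≥ ρ vᵀv`). [folklore] -/
theorem ClusterReadyNeg.dialReady {q : ℕ} {ρ : ℝ} (h : ClusterReadyNeg q ρ) : DialReady q ρ := by
  intro δ hδ
  obtain ⟨win, hq, x, y, v₀, -, -, -, hv₀, -, hZv, hρ⟩ := h (δ / 2) (by positivity)
  have hvv : 0 < v₀ ⬝ᵥ v₀ := dotProduct_self_pos_of_ne_zero hv₀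
  refine ⟨win, hq, v₀, by nlinarith, ?_⟩
  have : ρ * (v₀ ⬝ᵥ v₀) ≤ -(v₀ ⬝ᵥ (primePattern q win *ᵥ v₀)) := by linarith
  exact le_trans this (neg_le_abs _)

/-- **PROVED — from the `∃`-window idiom to file 3's sequence package** (one window per `δ = 1/(n+1)`, by
choice). [folklore] -/
theorem ClusterReady.exists_clusterBindersLight {q : ℕ} {ρ : ℝ} (h : ClusterReady q ρ) :
    ∃ W : ℕ → Window, ClusterBindersLight q W ρ := by
  choose W hW using fun n : ℕ => h (1 / ((n : ℝ) + 1)) (by positivity)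
  refine ⟨W, ⟨fun n => (hW n).1, fun δ hδ => ?_⟩⟩
  obtain ⟨n, hn⟩ := exists_nat_gt (1 / δ)
  have hnδ : 1 / ((n : ℝ) + 1) ≤ δ := by
    rw [div_le_iff₀ (by positivity)]
    have h1 : 1 / δ * δ = 1 := by field_simp
    nlinarith [h1, hδ]
  obtain ⟨x, y, v₀, hx, hy, hxy, hv₀, hZ, hZv, hρ⟩ := (hW n).2
  refine ⟨n, x, y, v₀, hx, hy, hxy, hv₀, fun α β => ?_, ?_, hρ⟩
  · exact le_trans (hZ α β) (mul_le_mul_of_nonneg_right hnδ (dotProduct_self_nonneg_real _))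
  · exact le_trans hZv (mul_le_mul_of_nonneg_right hnδ (dotProduct_self_nonneg_real _))

/-- **PROVED — the down-dial sign.** [folklore] -/
theorem ClusterReadyNeg.exists_clusterBindersNegLight {q : ℕ} {ρ : ℝ} (h : ClusterReadyNeg q ρ) :
    ∃ W : ℕ → Window, ClusterBindersNegLight q W ρ := by
  choose W hW using fun n : ℕ => h (1 / ((n : ℝ) + 1)) (by positivity)
  refine ⟨W, ⟨fun n => (hW n).1, fun δ hδ => ?_⟩⟩
  obtain ⟨n, hn⟩ := exists_nat_gt (1 / δ)
  have hnδ : 1 / ((n : ℝ) + 1) ≤ δ := by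
    rw [div_le_iff₀ (by positivity)]
    have h1 : 1 / δ * δ = 1 := by field_simp
    nlinarith [h1, hδ]
  obtain ⟨x, y, v₀, hx, hy, hxy, hv₀, hZ, hZv, hρ⟩ := (hW n).2
  refine ⟨n, x, y, v₀, hx, hy, hxy, hv₀, fun α β => ?_, ?_, hρ⟩
  · exact le_trans (hZ α β) (mul_le_mul_of_nonneg_right hnδ (dotProduct_self_nonneg_real _))
  · exact le_trans hZv (mul_le_mul_of_nonneg_right hnδ (dotProduct_self_nonneg_real _))

/-- **PROVED — DIAL ISOLATION MODULO `ClusterReady` ONLY (up-dials):** for every `0 ≤ τ < 1` with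
`τ(1 + ρ) < ρ` and every amplitude `t = 2(K − 1)w(q) > 0`, `datumOf (dial q K w_ζ) ∉ GaugeRatioClass τ`.
[folklore] -/
theorem upDial_not_mem_gaugeRatioClass_of_clusterReady {q : ℕ} {ρ : ℝ} (h : ClusterReady q ρ) {τ : ℝ}
    (hτ0 : 0 ≤ τ) (hτ : τ < 1) (hτρ : τ * (1 + ρ) < ρ) {K : ℝ} (ht : 0 < 2 * (K - 1) * zetaWeights q) :
    datumOf (dial q K zetaWeights) ∉ GaugeRatioClass τ := by
  obtain ⟨W, hW⟩ := h.exists_clusterBindersLight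
  exact upDial_not_mem_gaugeRatioClass_light hW hτ0 hτ hτρ ht

/-- **PROVED — DIAL ISOLATION MODULO `ClusterReadyNeg` ONLY (down-dials).** [folklore] -/
theorem downDial_not_mem_gaugeRatioClass_of_clusterReadyNeg {q : ℕ} {ρ : ℝ} (h : ClusterReadyNeg q ρ) {τ : ℝ}
    (hτ0 : 0 ≤ τ) (hτ : τ < 1) (hτρ : τ * (1 + ρ) < ρ) {K : ℝ} (ht : 2 * (K - 1) * zetaWeights q < 0) :
    datumOf (dial q K zetaWeights) ∉ GaugeRatioClass τ := by
  obtain ⟨W, hW⟩ := h.exists_clusterBindersNegLight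
  exact downDial_not_mem_gaugeRatioClass_light hW hτ0 hτ hτρ ht

/-- **PROVED — BOTH SIGNS, modulo `ClusterReady q ρ ∧ ClusterReadyNeg q ρ′`:** the only `q`-dial of `ζ` in
`GaugeRatioClass τ` (`0 ≤ τ < 1`, `τ(1 + ρ) < ρ`, `τ(1 + ρ′) < ρ′`) is the trivial one. [folklore] -/
theorem dial_mem_gaugeRatioClass_imp_trivial_of_clusterReady {q : ℕ} {ρ ρ' : ℝ} (h : ClusterReady q ρ)
    (h' : ClusterReadyNeg q ρ') {τ : ℝ} (hτ0 : 0 ≤ τ) (hτ : τ < 1) (hτρ : τ * (1 + ρ) < ρ)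
    (hτρ' : τ * (1 + ρ') < ρ') {K : ℝ} (hmem : datumOf (dial q K zetaWeights) ∈ GaugeRatioClass τ) :
    (K - 1) * zetaWeights q = 0 := by
  obtain ⟨W, hW⟩ := h.exists_clusterBindersLight
  obtain ⟨W', hW'⟩ := h'.exists_clusterBindersNegLight
  by_contra hne
  rcases lt_or_gt_of_ne hne with hlt | hgt
  · exact downDial_not_mem_gaugeRatioClass_light hW' hτ0 hτ hτρ' (K := K) (by linarith) hmem
  · exact upDial_not_mem_gaugeRatioClass_light hW hτ0 hτ hτρ (K := K) (by linarith) hmem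

/-- **PROVED — FOR THE CARVER: every class inside the `∀`-window gauge-ratio conjunct misses every up-dial at `q`,
modulo `ClusterReady q ρ` only** (`0 ≤ τ < 1`, `τ(1 + ρ) < ρ`). Combined with file 1
(`not_separates_of_strictGaugeRatio_subset`: its finite-window stages never separate, unconditionally) this is the
`(Z)`-cell's typed verdict on the dial door. [folklore] -/
theorem subset_gaugeRatioClass_disjoint_upDials_of_clusterReady {S : Set Datum} {τ : ℝ}
    (hS : S ⊆ GaugeRatioClass τ) {q : ℕ} {ρ : ℝ} (h : ClusterReady q ρ) (hτ0 : 0 ≤ τ) (hτ : τ < 1)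
    (hτρ : τ * (1 + ρ) < ρ) {K : ℝ} (ht : 0 < 2 * (K - 1) * zetaWeights q) :
    datumOf (dial q K zetaWeights) ∉ S :=
  fun hmem => upDial_not_mem_gaugeRatioClass_of_clusterReady h hτ0 hτ hτρ ht (hS hmem)

/-- PROVED (range): under `ClusterReady q ρ` the floor satisfies `ρ ≤ 1`, so the isolation window is
`τ < ρ/(1 + ρ) ≤ 1/2`. [folklore] -/
theorem ClusterReady.floor_le_one {q : ℕ} {ρ : ℝ} (h : ClusterReady q ρ) : ρ ≤ 1 := by
  obtain ⟨win, hq, x, y, v₀, -, -, -, hv₀, -, -, hρ⟩ := h 1 one_pos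
  exact patternFloor_le_one hq hv₀ hρ

end Summit.RiemannHypothesis.RiemannHypothesis.Theorems.PfPersistence

end
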